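import Summits.Ventures.YMGap.RobustBall.ZTwoLayerIsing
import Summits.Ventures.YMGap.Conjectures.ChiralClockComparisonSingleEdge
import HarnessLib

/-!
# RobustBall/ZThreeLayerGeometry — the `SU(3)` / `ℤ₃` layer: oriented reading of the free links, the complex clock coupling of a plaquette,
# the character `ψ₃ = ω^{·}` and its `√3`-chords

HONEST FRAMING: venture file of the cell `pub-ymgap` (QuantumFields programme), track Y2 ROBUST-BALL, seat ds-4 (g15).  Finite combinatorics and
trigonometry for the `N = 3` layer system of the centre-projected Wilson action (no twist defect), shared by the comparison file
`RobustBall/ZThreeLayerClock.lean` and the Dobrushin file `RobustBall/CentreBlindOscWindow.lean`: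
* `ψ_three_eq_omegaPow` (`ψ₃ = ω^{·}` of `Conjectures/ChiralClockComparison.lean`), `re_mul_ψ_three` (`Re(z ψ₃(m)) = ‖z‖ cos(2π val(m)/3 + arg z)`),
  `norm_ψ_three_sub_le` (the chords of the triangle: `‖ψ₃ a − ψ₃ b‖ ≤ √3`);
* `src`, `snk`, `transFlux₃`, **`flux_glue_eq`**: a plaquette with a side of direction `i` reads its two free `i`-links WITH ORIENTATION,
  `(curl k)_p = σ(src p) − σ(snk p) + T_p`; `iSites_eq_pair` (`iSites i p = {src p, snk p}`);
* `plaqCoupling` `ζ_p = β ψ₃(T_p) tr U_p`, `norm_plaqCoupling_le` (`‖ζ_p‖ ≤ 3|β|`), `activity_double_diff_le` (the mixed second difference of the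
  plaquette activity `β Re(ψ₃(m − n + T_p) tr U_p)` in `(m, n)` is at most `3‖ζ_p‖ ≤ 9|β|` — the `ℤ₃` chord `√3` squared, against the generic `4·3|β|`).
Strong-coupling lattice bookkeeping; nothing continuum / Clay.
-/

noncomputable section

open Finset
open Literature.MathematicalPhysics.QuantumFieldTheory
open Summit.Ventures.YMGap.Conjectures (omegaPow omegaPow_zero omegaPow_one omegaPow_two)

namespace Summit.Ventures.YMGap.RobustBall

namespace ZThree

open ZN ZNFluxW ZTwo

variable {d L : ℕ}

/-! ### The character `ψ₃` -/

/-- `ψ₃ = ω^{·}`: the standard additive character of `ℤ/3` of the tree is the `omegaPow` of `Conjectures/ChiralClockComparison.lean`.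
[folklore] -/
theorem ψ_three_eq_omegaPow (m : ZMod 3) : ψ 3 m = omegaPow m := by
  simp only [ψ, ZMod.stdAddChar_apply, ZMod.toCircle_apply, omegaPow, Nat.cast_ofNat]

/-- `Re(z · ψ₃(m)) = ‖z‖ cos(2π·val(m)/3 + arg z)`. [folklore] -/
theorem re_mul_ψ_three (z : ℂ) (m : ZMod 3) :
    (z * ψ 3 m).re = ‖z‖ * Real.cos (2 * Real.pi * ((m.val : ℕ) : ℝ) / 3 + Complex.arg z) := by
  have hz := Complex.norm_mul_exp_arg_mul_I z
  have hψ : ψ 3 m = Complex.exp (((2 * Real.pi * ((m.val : ℕ) : ℝ) / 3 : ℝ) : ℂ) * Complex.I) := by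
    rw [ψ_three_eq_omegaPow]
    unfold omegaPow
    congr 1
    push_cast
    ring
  rw [hψ]
  conv_lhs => rw [← hz]
  rw [mul_assoc, ← Complex.exp_add, ← add_mul, show (Complex.arg z : ℂ) + ((2 * Real.pi * ((m.val : ℕ) : ℝ) / 3 : ℝ) : ℂ) =
    ((2 * Real.pi * ((m.val : ℕ) : ℝ) / 3 + Complex.arg z : ℝ) : ℂ) by push_cast; ring, Complex.re_ofReal_mul,
    Complex.exp_ofReal_mul_I_re]

/-- **The chords of the triangle**: `‖ψ₃(a) − ψ₃(b)‖ ≤ √3`. [folklore] -/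
theorem norm_ψ_three_sub_le (a b : ZMod 3) : ‖ψ 3 a - ψ 3 b‖ ≤ Real.sqrt 3 := by
  have h33 : Real.sqrt 3 * Real.sqrt 3 = 3 := Real.mul_self_sqrt (by norm_num)
  have hfac : ψ 3 a - ψ 3 b = ψ 3 b * (ψ 3 (a - b) - 1) := by
    rw [mul_sub, mul_one, ← ψ_add, add_sub_cancel]
  rw [hfac, norm_mul, norm_ψ, one_mul, ψ_three_eq_omegaPow]
  have key : ∀ d : ZMod 3, ‖omegaPow d - 1‖ ≤ Real.sqrt 3 := by
    intro d
    have hcases : d = 0 ∨ d = 1 ∨ d = 2 := by revert d; decide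
    rcases hcases with rfl | rfl | rfl
    · rw [omegaPow_zero, sub_self, norm_zero]; positivity
    · rw [omegaPow_one, show ((⟨-1 / 2, Real.sqrt 3 / 2⟩ : ℂ) - 1) = ⟨-3 / 2, Real.sqrt 3 / 2⟩ by
        apply Complex.ext <;> simp; norm_num]
      refine le_of_eq ?_
      rw [Complex.norm_def, Complex.normSq_mk]
      rw [show (-3 / 2 : ℝ) * (-3 / 2) + Real.sqrt 3 / 2 * (Real.sqrt 3 / 2) = Real.sqrt 3 * Real.sqrt 3 by nlinarith [h33]]
      exact Real.sqrt_mul_self (Real.sqrt_nonneg 3)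
    · rw [omegaPow_two, show ((⟨-1 / 2, -(Real.sqrt 3 / 2)⟩ : ℂ) - 1) = ⟨-3 / 2, -(Real.sqrt 3 / 2)⟩ by
        apply Complex.ext <;> simp; norm_num]
      refine le_of_eq ?_
      rw [Complex.norm_def, Complex.normSq_mk]
      rw [show (-3 / 2 : ℝ) * (-3 / 2) + -(Real.sqrt 3 / 2) * -(Real.sqrt 3 / 2) = Real.sqrt 3 * Real.sqrt 3 by nlinarith [h33]]
      exact Real.sqrt_mul_self (Real.sqrt_nonneg 3)
  exact key (a - b)

/-! ### A layer plaquette reads its two `i`-links, with orientation -/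

/-- The `i`-link entering the flux of `p` with sign `+`: `z` if `p = (z; i < b)`, `z + e_a` if `p = (z; a < i)`. [folklore] -/
def src (i : Fin d) (p : Plaquette d L) : Site d L := if p.2.1.1 = i then p.1 else p.1.shift p.2.1.1

/-- The `i`-link entering the flux of `p` with sign `−`: `z + e_b` if `p = (z; i < b)`, `z` if `p = (z; a < i)`. [folklore] -/
def snk (i : Fin d) (p : Plaquette d L) : Site d L := if p.2.1.1 = i then p.1.shift p.2.1.2 else p.1

/-- `iSites i p = {src p, snk p}` for a plaquette with a side of direction `i`. [folklore] -/
theorem iSites_eq_pair (i : Fin d) (p : Plaquette d L) (hp : p.2.1.1 = i ∨ p.2.1.2 = i) :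
    iSites i p = {src i p, snk i p} := by
  unfold iSites src snk
  by_cases h1 : p.2.1.1 = i
  · simp [h1]
  · have h2 : p.2.1.2 = i := hp.resolve_left h1
    simp [h1, h2]

/-- The transverse flux of a plaquette: its flux with all `i`-links set to `0`. [folklore] -/
def transFlux₃ (i : Fin d) (kT : Transverse d L (ZMod 3) i) (p : Plaquette d L) : ZMod 3 := flux (ZN.glue i (fun _ => 0) kT) p

/-- **ORIENTED READING OF THE FREE LINKS**: for a plaquette with a side of direction `i`,
`(curl k)_p = σ(src p) − σ(snk p) + T_p`. [folklore] -/
theorem flux_glue_eq (i : Fin d) (σ : Site d L → ZMod 3) (kT : Transverse d L (ZMod 3) i) (p : Plaquette d L)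
    (hp : p.2.1.1 = i ∨ p.2.1.2 = i) :
    flux (ZN.glue i σ kT) p = σ (src i p) - σ (snk i p) + transFlux₃ i kT p := by
  obtain ⟨z, ⟨⟨a, b⟩, hab⟩⟩ := p
  have hne : a ≠ b := (show a < b from hab).ne
  simp only at hp
  unfold transFlux₃ flux plaqSum src snk
  rcases hp with rfl | rfl
  · have hb : b ≠ a := hne.symm
    simp only [if_true]
    rw [glue_apply_site, glue_apply_site, glue_apply_site, glue_apply_site,
      glue_apply_of_ne _ _ (show ((z.shift a, b) : Edge d L).2 ≠ a from hb),
      glue_apply_of_ne _ _ (show ((z, b) : Edge d L).2 ≠ a from hb),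
      glue_apply_of_ne _ _ (show ((z.shift a, b) : Edge d L).2 ≠ a from hb),
      glue_apply_of_ne _ _ (show ((z, b) : Edge d L).2 ≠ a from hb)]
    ring
  · simp only [hne, if_false]
    rw [glue_apply_site, glue_apply_site, glue_apply_site, glue_apply_site,
      glue_apply_of_ne _ _ (show ((z, a) : Edge d L).2 ≠ b from hne),
      glue_apply_of_ne _ _ (show ((z.shift b, a) : Edge d L).2 ≠ b from hne),
      glue_apply_of_ne _ _ (show ((z, a) : Edge d L).2 ≠ b from hne),
      glue_apply_of_ne _ _ (show ((z.shift b, a) : Edge d L).2 ≠ b from hne)]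
    ring

/-! ### The complex clock coupling of a layer plaquette -/

/-- **The complex clock coupling of a layer plaquette** in the background `(U, kT)`: `ζ_p = β ψ₃(T_p) tr U_p`. [folklore] -/
def plaqCoupling (β : ℝ) (U : GaugeConfig d L (SUN 3)) (i : Fin d) (kT : Transverse d L (ZMod 3) i) (p : Plaquette d L) : ℂ :=
  (β : ℂ) * ψ 3 (transFlux₃ i kT p) * ((plaquetteHolonomy U p.1 p.2.1.1 p.2.1.2 : SUN 3) : Matrix (Fin 3) (Fin 3) ℂ).trace

/-- `‖ζ_p‖ ≤ 3|β|`. [folklore] -/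
theorem norm_plaqCoupling_le (β : ℝ) (U : GaugeConfig d L (SUN 3)) (i : Fin d) (kT : Transverse d L (ZMod 3) i) (p : Plaquette d L) :
    ‖plaqCoupling β U i kT p‖ ≤ 3 * |β| := by
  unfold plaqCoupling
  rw [norm_mul, norm_mul, Complex.norm_real, Real.norm_eq_abs, norm_ψ, mul_one]
  have h := norm_trace_le (plaquetteHolonomy U p.1 p.2.1.1 p.2.1.2 : SUN 3)
  calc |β| * ‖((plaquetteHolonomy U p.1 p.2.1.1 p.2.1.2 : SUN 3) : Matrix (Fin 3) (Fin 3) ℂ).trace‖ ≤ |β| * 3 :=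
        mul_le_mul_of_nonneg_left (by exact_mod_cast h) (abs_nonneg β)
    _ = 3 * |β| := by ring

/-- On a layer plaquette the activity is a chiral clock term: `β Re(ψ₃(m + T_p) tr U_p) = ‖ζ_p‖ cos(2π·val(m)/3 + arg ζ_p)`. [folklore] -/
theorem activity_eq_clock (β : ℝ) (U : GaugeConfig d L (SUN 3)) (i : Fin d) (kT : Transverse d L (ZMod 3) i) (p : Plaquette d L)
    (m : ZMod 3) :
    β * (ψ 3 (m + transFlux₃ i kT p) * ((plaquetteHolonomy U p.1 p.2.1.1 p.2.1.2 : SUN 3) : Matrix (Fin 3) (Fin 3) ℂ).trace).re =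
      ‖plaqCoupling β U i kT p‖ * Real.cos (2 * Real.pi * ((m.val : ℕ) : ℝ) / 3 + Complex.arg (plaqCoupling β U i kT p)) := by
  rw [← re_mul_ψ_three, plaqCoupling, ψ_add, ← Complex.re_ofReal_mul]
  congr 1
  ring

/-- The activity as a function of the two link values: `β Re(ψ₃(m − n + T_p) tr U_p) = Re(ζ_p ψ₃(m) conj-free form)`. [folklore] -/
theorem activity_eq_re (β : ℝ) (U : GaugeConfig d L (SUN 3)) (i : Fin d) (kT : Transverse d L (ZMod 3) i) (p : Plaquette d L)
    (m n : ZMod 3) :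
    β * (ψ 3 (m - n + transFlux₃ i kT p) * ((plaquetteHolonomy U p.1 p.2.1.1 p.2.1.2 : SUN 3) : Matrix (Fin 3) (Fin 3) ℂ).trace).re =
      (plaqCoupling β U i kT p * (ψ 3 m * ψ 3 (-n))).re := by
  rw [plaqCoupling, ← Complex.re_ofReal_mul]
  congr 1
  rw [← ψ_add, show m - n + transFlux₃ i kT p = transFlux₃ i kT p + (m + -n) by ring, ψ_add]
  ring

/-- **THE MIXED SECOND DIFFERENCE OF THE PLAQUETTE ACTIVITY IS AT MOST `3‖ζ_p‖`** (the `ℤ₃` chord `√3`, squared):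
for `F(m, n) = β Re(ψ₃(m − n + T_p) tr U_p)`, `F(m,n) − F(m,n') − F(m',n) + F(m',n') ≤ 3‖ζ_p‖ ≤ 9|β|` — against the generic `4 · 3|β|`
of a term bounded by `3|β|`. [folklore] -/
theorem activity_double_diff_le (β : ℝ) (U : GaugeConfig d L (SUN 3)) (i : Fin d) (kT : Transverse d L (ZMod 3) i) (p : Plaquette d L)
    (m m' n n' : ZMod 3) :
    β * (ψ 3 (m - n + transFlux₃ i kT p) * ((plaquetteHolonomy U p.1 p.2.1.1 p.2.1.2 : SUN 3) : Matrix (Fin 3) (Fin 3) ℂ).trace).re -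
        β * (ψ 3 (m - n' + transFlux₃ i kT p) * ((plaquetteHolonomy U p.1 p.2.1.1 p.2.1.2 : SUN 3) : Matrix (Fin 3) (Fin 3) ℂ).trace).re -
        β * (ψ 3 (m' - n + transFlux₃ i kT p) * ((plaquetteHolonomy U p.1 p.2.1.1 p.2.1.2 : SUN 3) : Matrix (Fin 3) (Fin 3) ℂ).trace).re +
        β * (ψ 3 (m' - n' + transFlux₃ i kT p) * ((plaquetteHolonomy U p.1 p.2.1.1 p.2.1.2 : SUN 3) : Matrix (Fin 3) (Fin 3) ℂ).trace).re ≤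
      3 * ‖plaqCoupling β U i kT p‖ := by
  simp only [activity_eq_re]
  set ζ := plaqCoupling β U i kT p with hζ
  have hfac : (ζ * (ψ 3 m * ψ 3 (-n))).re - (ζ * (ψ 3 m * ψ 3 (-n'))).re - (ζ * (ψ 3 m' * ψ 3 (-n))).re + (ζ * (ψ 3 m' * ψ 3 (-n'))).re =
      (ζ * ((ψ 3 m - ψ 3 m') * (ψ 3 (-n) - ψ 3 (-n')))).re := by
    rw [← Complex.sub_re, ← Complex.sub_re, ← Complex.add_re]
    congr 1
    ring
  rw [hfac]
  refine (Complex.re_le_norm _).trans ?_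
  rw [norm_mul, norm_mul]
  have h1 := norm_ψ_three_sub_le m m'
  have h2 := norm_ψ_three_sub_le (-n) (-n')
  have h33 : Real.sqrt 3 * Real.sqrt 3 = 3 := Real.mul_self_sqrt (by norm_num)
  calc ‖ζ‖ * (‖ψ 3 m - ψ 3 m'‖ * ‖ψ 3 (-n) - ψ 3 (-n')‖) ≤ ‖ζ‖ * (Real.sqrt 3 * Real.sqrt 3) :=
        mul_le_mul_of_nonneg_left (mul_le_mul h1 h2 (norm_nonneg _) (Real.sqrt_nonneg 3)) (norm_nonneg _)
    _ = 3 * ‖ζ‖ := by rw [h33]; ring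

end ZThree

end Summit.Ventures.YMGap.RobustBall

end
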